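import Summits.CriticalPhenomena.Ising3DConformalLimit.Theses.ArmHyperscaling
import HarnessLib

/-!
# Crux `ArmHyperscaling.IsotropyFromOneArm` (stmt-CriticalPhenomena-15593) — Negative/LoadBearing:
# which hypotheses of the consequent are load-bearing

Standing crux disprover `refuter-cdisprove-stmt-CriticalPhenomena-15593-0`, cycle 1 (2026-08-17); NEGATIVE LEMMAS
about the load-bearing hypotheses of THIS crux only (no route statement is asserted positively here).

The crux is `OneArmHyperscaling → C` with
`C := ∀ ρ Δ S, (H1) ρ > 0 on (0,1] → (H2) HasPointwiseScalingLimit (criticalCorr 3) ρ S →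
  (H3) S = 0 off NonCoincident → (H4) IsNondegenerateTwoPoint S → (H5) IsTranslationInvariant S →
  (H6) IsScaleCovariant Δ S → IsRotationInvariant S`.
`C` itself is a theorem of the tree (`limitRotationInvariant_proof HRP2Rigidity_of`, cruxes 1980/1979; the candidate
proof of the crux is attached to the item), so the antecedent is inert and no variant `OneArmHyperscaling → C⁻` can be
refuted without proving the (open) one-arm bound; the analysis is therefore on `C`:

* `consequent_false_without_limit` — dropping (H2) makes `C` FALSE: the explicit family `witnessA`
  (`S₂(x,y) = (‖v‖ + |v₀|)/‖v‖²`, `v = x - y`, other orders `0`) is normalised, non-degenerate, translation invariant,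
  scale covariant with `Δ = 1/2`, and not `O(3)` invariant (`S₂(e₀,0) = 2 ≠ 1 = S₂(e₁,0)`).  Any proof must use that
  `S` is a limit of the `ℤ³` correlators.
* `consequentWithoutNorm_iff_no_limit` — dropping (H3) makes `C` EQUIVALENT to the non-existence of any non-degenerate,
  translation-invariant, scale-covariant pointwise limit of `criticalCorr 3`: the values of `S` on the coincident locus
  are unconstrained by (H2),(H4)–(H6) and can be grafted anisotropically at order 4 (`graft S`).  Corollary
  `consequent_false_without_norm_of_exists : ExistsScaleCovariantLimit → ¬ (C without (H3))` — the coincident-locus junk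
  that refuted item 0637 (`not_inversionUpgrade_of_euclideanLimit`), now for rotations.

(H5),(H6) are redundant (`MoebiusLimitExistsNegative.isTranslationInvariant_normalised_of_limit`,
`….exists_scaleCovariant_normalised`) and (H1),(H4) need a genuine limit witness — see the crux work file
`Cruxes/IsotropyFromOneArm/Disproof.lean` §C.
-/

noncomputable section

open Literature.Probability.LatticeModels Filter Topology

namespace Summit.CriticalPhenomena.Ising3DConformalLimit.Cruxes.IsotropyFromOneArm.Negative

/-- Shorthand for the Euclidean space `ℝ³`. [folklore] -/
abbrev E3 : Type := EuclideanSpace ℝ (Fin 3)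

/-! ## (H2) is load-bearing: without the lattice-limit hypothesis the consequent is false -/

/-- The anisotropic kernel `(‖v‖ + |v₀|) / ‖v‖²`, homogeneous of degree `-1`, vanishing at `0`. [folklore] -/
def anisoKernel (v : E3) : ℝ := (‖v‖ + |v 0|) * (‖v‖ ^ 2)⁻¹

/-- `anisoKernel 0 = 0`. [folklore] -/
theorem anisoKernel_zero : anisoKernel 0 = 0 := by simp [anisoKernel]

/-- `anisoKernel v > 0` for `v ≠ 0`. [folklore] -/
theorem anisoKernel_pos {v : E3} (hv : v ≠ 0) : 0 < anisoKernel v := by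
  have h : 0 < ‖v‖ := norm_pos_iff.mpr hv
  exact mul_pos (add_pos_of_pos_of_nonneg h (abs_nonneg _)) (inv_pos.mpr (pow_pos h 2))

/-- Homogeneity of degree `-1`. [folklore] -/
theorem anisoKernel_smul {c : ℝ} (hc : 0 < c) (v : E3) : anisoKernel (c • v) = c⁻¹ * anisoKernel v := by
  by_cases hv : v = 0
  · subst hv; simp [anisoKernel_zero]
  · have h : 0 < ‖v‖ := norm_pos_iff.mpr hv
    simp only [anisoKernel, norm_smul, PiLp.smul_apply, smul_eq_mul, abs_mul, Real.norm_eq_abs,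
      abs_of_pos hc]
    field_simp

/-- Witness A: `S₂(x₀,x₁) = anisoKernel (x₀ - x₁)`, all other orders `0`. [folklore] -/
def witnessA : CorrFamily 3 := fun n =>
  match n with
  | 2 => fun x => anisoKernel (x 0 - x 1)
  | _ => fun _ => 0

/-- Unfolding of the two-point function of witness A. [folklore] -/
theorem witnessA_two (x : Fin 2 → E3) : witnessA 2 x = anisoKernel (x 0 - x 1) := rfl

/-- Witness A is normalised (vanishes off the non-coincident locus). [folklore] -/
theorem witnessA_normalised : ∀ n z, z ∉ NonCoincident 3 n → witnessA n z = 0 := by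
  intro n z hz
  match n, z with
  | 2, z =>
    have h01 : z 0 = z 1 := by
      by_contra h
      apply hz
      intro i j hij
      fin_cases i <;> fin_cases j
      · rfl
      · exact absurd hij h
      · exact absurd hij.symm h
      · rfl
    rw [witnessA_two, h01, sub_self, anisoKernel_zero]
  | 0, _ => rfl
  | 1, _ => rfl
  | 3, _ => rfl
  | (n + 4), _ => rfl

/-- Witness A has a non-degenerate two-point function. [folklore] -/
theorem witnessA_isNondegenerateTwoPoint : IsNondegenerateTwoPoint witnessA := by
  intro x hx
  have hne : x 0 ≠ x 1 := fun h => absurd ((mem_nonCoincident x).1 hx h) (by decide)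
  rw [witnessA_two]
  exact anisoKernel_pos (sub_ne_zero.mpr hne)

/-- Witness A is translation invariant. [folklore] -/
theorem witnessA_isTranslationInvariant : IsTranslationInvariant witnessA := by
  intro n v x
  match n, x with
  | 2, x => simp [witnessA_two]
  | 0, _ => rfl
  | 1, _ => rfl
  | 3, _ => rfl
  | (n + 4), _ => rfl

/-- Witness A is scale covariant with `Δ = 1/2`. [folklore] -/
theorem witnessA_isScaleCovariant : IsScaleCovariant (1 / 2) witnessA := by
  intro n c hc x
  match n, x with
  | 2, x =>
    have h1 : (-((2 : ℕ) : ℝ) * (1 / 2)) = -1 := by norm_num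
    rw [witnessA_two, witnessA_two, h1, Real.rpow_neg_one, ← smul_sub, anisoKernel_smul hc]
  | 0, _ => simp [witnessA]
  | 1, _ => simp [witnessA]
  | 3, _ => simp [witnessA]
  | (n + 4), _ => simp [witnessA]

/-- The unit vector `e₀`. [folklore] -/
def e0 : E3 := EuclideanSpace.single 0 1

/-- The unit vector `e₁`. [folklore] -/
def e1 : E3 := EuclideanSpace.single 1 1

/-- `‖e₀‖ = 1`. [folklore] -/
theorem norm_e0 : ‖e0‖ = 1 := by simp [e0]

/-- `‖e₁‖ = 1`. [folklore] -/
theorem norm_e1 : ‖e1‖ = 1 := by simp [e1]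

/-- `anisoKernel e₀ = 2`. [folklore] -/
theorem anisoKernel_e0 : anisoKernel e0 = 2 := by
  rw [anisoKernel, norm_e0]; simp [e0]; norm_num

/-- `anisoKernel e₁ = 1`. [folklore] -/
theorem anisoKernel_e1 : anisoKernel e1 = 1 := by
  rw [anisoKernel, norm_e1]; simp [e1]

/-- A linear isometry of `ℝ³` taking `e₀` to `e₁` (Householder reflection). [folklore] -/
def swap01 : E3 ≃ₗᵢ[ℝ] E3 := (ℝ ∙ (e0 - e1))ᗮ.reflection

/-- `swap01 e₀ = e₁`. [folklore] -/
theorem swap01_e0 : swap01 e0 = e1 := Submodule.reflection_sub (by rw [norm_e0, norm_e1])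

/-- Witness A is not `O(3)` invariant: `S₂(e₀,0) = 2 ≠ 1 = S₂(e₁,0)`. [folklore] -/
theorem witnessA_not_isRotationInvariant : ¬ IsRotationInvariant witnessA := by
  intro hR
  have h := hR 2 swap01 ![e0, 0]
  have hl : (fun i => swap01 ((![e0, 0] : Fin 2 → E3) i)) = ![e1, 0] := by
    funext i; fin_cases i <;> simp [swap01_e0]
  rw [hl, witnessA_two, witnessA_two] at h
  simp only [Matrix.cons_val_zero, Matrix.cons_val_one, sub_zero, anisoKernel_e0,
    anisoKernel_e1] at h
  norm_num at h

/-- **(H2) is load-bearing** (`IsotropyFromOneArm`'s consequent with the lattice-limit hypothesis dropped is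
FALSE): any proof must use that `S` is a scaling limit of the critical `ℤ³` Ising correlators — the purely
axiomatic remainder (normalised, non-degenerate, translation invariant, scale covariant ⇒ `O(3)`) fails on
`witnessA`. [folklore] -/
theorem consequent_false_without_limit :
    ¬ ∀ (ρ : ℝ → ℝ) (Δ : ℝ) (S : CorrFamily 3), (∀ δ ∈ Set.Ioc (0:ℝ) 1, 0 < ρ δ) →
      (∀ n z, z ∉ NonCoincident 3 n → S n z = 0) →
      IsNondegenerateTwoPoint S → IsTranslationInvariant S → IsScaleCovariant Δ S →
      IsRotationInvariant S := fun h =>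
  witnessA_not_isRotationInvariant
    (h (fun _ => 1) (1 / 2) witnessA (fun _ _ => one_pos) witnessA_normalised
      witnessA_isNondegenerateTwoPoint witnessA_isTranslationInvariant witnessA_isScaleCovariant)

/-! ## (H3) is load-bearing modulo existence: without the normalisation the statement is junk -/

/-- The degree-`0` anisotropic factor `|v₀| / ‖v‖` (`= 0` at `v = 0`). [folklore] -/
def dirFactor (v : E3) : ℝ := |v 0| / ‖v‖

/-- `dirFactor` is invariant under positive dilations. [folklore] -/
theorem dirFactor_smul {c : ℝ} (hc : 0 < c) (v : E3) : dirFactor (c • v) = dirFactor v := by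
  simp only [dirFactor, norm_smul, PiLp.smul_apply, smul_eq_mul, abs_mul, Real.norm_eq_abs, abs_of_pos hc]
  exact mul_div_mul_left _ _ hc.ne'

/-- `dirFactor (-e₀) = 1`. [folklore] -/
theorem dirFactor_e0 : dirFactor (-e0) = 1 := by
  rw [dirFactor, norm_neg, norm_e0]; simp [e0]

/-- `dirFactor (-e₁) = 0`. [folklore] -/
theorem dirFactor_e1 : dirFactor (-e1) = 0 := by
  rw [dirFactor, norm_neg, norm_e1]; simp [e1]

/-- The anisotropic graft term, supported at order `4`: `S₂(z₀,z₂)·S₂(z₁,z₃)·dirFactor(z₀ - z₂)`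
(degree `-4Δ` whenever `S` is `Δ`-scale covariant). [folklore] -/
def graftTerm (S : CorrFamily 3) : CorrFamily 3 := fun n =>
  match n with
  | 4 => fun z => S 2 ![z 0, z 2] * S 2 ![z 1, z 3] * dirFactor (z 0 - z 2)
  | _ => fun _ => 0

/-- Unfolding of the graft term at order `4`. [folklore] -/
theorem graftTerm_four (S : CorrFamily 3) (z : Fin 4 → E3) :
    graftTerm S 4 z = S 2 ![z 0, z 2] * S 2 ![z 1, z 3] * dirFactor (z 0 - z 2) := rfl

/-- `graft S`: `S` on non-coincident configurations, the anisotropic graft term on the coincident locus.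
[folklore] -/
def graft (S : CorrFamily 3) : CorrFamily 3 := fun n z =>
  open Classical in if z ∈ NonCoincident 3 n then S n z else graftTerm S n z

/-- `graft S = S` on the non-coincident locus. [folklore] -/
theorem graft_of_mem {S : CorrFamily 3} {n : ℕ} {z : Fin n → E3} (hz : z ∈ NonCoincident 3 n) :
    graft S n z = S n z := by simp [graft, hz]

/-- `graft S = graftTerm S` on the coincident locus. [folklore] -/
theorem graft_of_not_mem {S : CorrFamily 3} {n : ℕ} {z : Fin n → E3} (hz : z ∉ NonCoincident 3 n) :
    graft S n z = graftTerm S n z := by simp [graft, hz]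

/-- Translations preserve (non-)coincidence. [folklore] -/
theorem mem_nonCoincident_add_iff {n : ℕ} (z : Fin n → E3) (v : E3) :
    (fun i => z i + v) ∈ NonCoincident 3 n ↔ z ∈ NonCoincident 3 n :=
  (add_left_injective v).of_comp_iff z

/-- Non-zero dilations preserve (non-)coincidence. [folklore] -/
theorem mem_nonCoincident_smul_iff {n : ℕ} (z : Fin n → E3) {c : ℝ} (hc : c ≠ 0) :
    (fun i => c • z i) ∈ NonCoincident 3 n ↔ z ∈ NonCoincident 3 n :=
  (smul_right_injective E3 hc).of_comp_iff z

/-- The graft has the same pointwise scaling limit property (the limit only sees `NonCoincident`). [folklore] -/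
theorem graft_hasLimit {S : CorrFamily 3} {ρ : ℝ → ℝ}
    (h : HasPointwiseScalingLimit (criticalCorr 3) ρ S) :
    HasPointwiseScalingLimit (criticalCorr 3) ρ (graft S) := fun n =>
  (h n).congr_right fun _ hz => (graft_of_mem hz).symm

/-- The graft of a non-degenerate family is non-degenerate. [folklore] -/
theorem graft_isNondegenerateTwoPoint {S : CorrFamily 3} (h : IsNondegenerateTwoPoint S) :
    IsNondegenerateTwoPoint (graft S) := fun x hx => by
  rw [graft_of_mem hx]; exact h x hx

/-- The graft term of a translation-invariant family is translation invariant. [folklore] -/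
theorem graftTerm_translate {S : CorrFamily 3} (hT : IsTranslationInvariant S) (n : ℕ) (v : E3)
    (z : Fin n → E3) : graftTerm S n (fun i => z i + v) = graftTerm S n z := by
  match n, z with
  | 4, z =>
    rw [graftTerm_four, graftTerm_four]
    have h02 := hT 2 v ![z 0, z 2]
    have h13 := hT 2 v ![z 1, z 3]
    have e02 : (fun i => (![z 0, z 2] : Fin 2 → E3) i + v) = ![z 0 + v, z 2 + v] := by
      funext i; fin_cases i <;> rfl
    have e13 : (fun i => (![z 1, z 3] : Fin 2 → E3) i + v) = ![z 1 + v, z 3 + v] := by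
      funext i; fin_cases i <;> rfl
    rw [e02] at h02
    rw [e13] at h13
    rw [h02, h13, add_sub_add_right_eq_sub]
  | 0, _ => rfl
  | 1, _ => rfl
  | 2, _ => rfl
  | 3, _ => rfl
  | (n + 5), _ => rfl

/-- The graft of a translation-invariant family is translation invariant. [folklore] -/
theorem graft_isTranslationInvariant {S : CorrFamily 3} (hT : IsTranslationInvariant S) :
    IsTranslationInvariant (graft S) := by
  intro n v z
  by_cases hz : z ∈ NonCoincident 3 n
  · rw [graft_of_mem hz, graft_of_mem ((mem_nonCoincident_add_iff z v).2 hz), hT]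
  · rw [graft_of_not_mem hz, graft_of_not_mem (fun h => hz ((mem_nonCoincident_add_iff z v).1 h)),
      graftTerm_translate hT]

/-- The graft term of a `Δ`-scale-covariant family is `Δ`-scale covariant. [folklore] -/
theorem graftTerm_smul {S : CorrFamily 3} {Δ : ℝ} (hS : IsScaleCovariant Δ S) (n : ℕ) {c : ℝ}
    (hc : 0 < c) (z : Fin n → E3) :
    graftTerm S n (fun i => c • z i) = c ^ (-(n : ℝ) * Δ) * graftTerm S n z := by
  match n, z with
  | 4, z =>
    rw [graftTerm_four, graftTerm_four]
    have h02 := hS 2 c hc ![z 0, z 2]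
    have h13 := hS 2 c hc ![z 1, z 3]
    have e02 : (fun i => c • (![z 0, z 2] : Fin 2 → E3) i) = ![c • z 0, c • z 2] := by
      funext i; fin_cases i <;> rfl
    have e13 : (fun i => c • (![z 1, z 3] : Fin 2 → E3) i) = ![c • z 1, c • z 3] := by
      funext i; fin_cases i <;> rfl
    rw [e02] at h02
    rw [e13] at h13
    rw [h02, h13, ← smul_sub, dirFactor_smul hc]
    have h4 : c ^ (-((4 : ℕ) : ℝ) * Δ) = c ^ (-((2 : ℕ) : ℝ) * Δ) * c ^ (-((2 : ℕ) : ℝ) * Δ) := by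
      rw [← Real.rpow_add hc]; congr 1; push_cast; ring
    rw [h4]; ring
  | 0, _ => simp [graftTerm]
  | 1, _ => simp [graftTerm]
  | 2, _ => simp [graftTerm]
  | 3, _ => simp [graftTerm]
  | (n + 5), _ => simp [graftTerm]

/-- The graft of a `Δ`-scale-covariant family is `Δ`-scale covariant. [folklore] -/
theorem graft_isScaleCovariant {S : CorrFamily 3} {Δ : ℝ} (hS : IsScaleCovariant Δ S) :
    IsScaleCovariant Δ (graft S) := by
  intro n c hc z
  by_cases hz : z ∈ NonCoincident 3 n
  · rw [graft_of_mem hz, graft_of_mem ((mem_nonCoincident_smul_iff z hc.ne').2 hz), hS n c hc z]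
  · rw [graft_of_not_mem hz,
      graft_of_not_mem (fun h => hz ((mem_nonCoincident_smul_iff z hc.ne').1 h)), graftTerm_smul hS n hc]

/-- The coincident test configuration `(0, 0, e₀, e₀)`. [folklore] -/
def cfg : Fin 4 → E3 := ![0, 0, e0, e0]

/-- `cfg` is coincident. [folklore] -/
theorem cfg_not_mem : cfg ∉ NonCoincident 3 4 := by
  intro h
  have := (mem_nonCoincident cfg).1 h (show cfg 0 = cfg 1 by simp [cfg])
  exact absurd this (by decide)

/-- The image of `cfg` under `swap01` is `(0, 0, e₁, e₁)`. [folklore] -/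
theorem swap_cfg_eq : (fun i => swap01 (cfg i)) = ![0, 0, e1, e1] := by
  funext i; fin_cases i <;> simp [cfg, swap01_e0]

/-- … which is coincident too. [folklore] -/
theorem swap_cfg_not_mem : (fun i => swap01 (cfg i)) ∉ NonCoincident 3 4 := by
  rw [swap_cfg_eq]
  intro h
  have := (mem_nonCoincident _).1 h (show (![0, 0, e1, e1] : Fin 4 → E3) 0 = ![0, 0, e1, e1] 1 by simp)
  exact absurd this (by decide)

/-- `e₀ ≠ 0`. [folklore] -/
theorem e0_ne_zero : e0 ≠ 0 := fun h => by simpa [h] using norm_e0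

/-- The pair `(0, e₀)` is non-coincident. [folklore] -/
theorem pair_mem : (![0, e0] : Fin 2 → E3) ∈ NonCoincident 3 2 := by
  rw [mem_nonCoincident]
  intro i j hij
  fin_cases i <;> fin_cases j
  · rfl
  · exact absurd hij.symm (by simpa using e0_ne_zero)
  · exact absurd hij (by simpa using e0_ne_zero)
  · rfl

/-- The graft of a non-degenerate family is not `O(3)` invariant:
`graft S 4 (0,0,e₀,e₀) = S₂(0,e₀)² > 0 = graft S 4 (0,0,e₁,e₁)`. [folklore] -/
theorem graft_not_isRotationInvariant {S : CorrFamily 3} (hnd : IsNondegenerateTwoPoint S) :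
    ¬ IsRotationInvariant (graft S) := by
  intro hR
  have h := hR 4 swap01 cfg
  rw [graft_of_not_mem swap_cfg_not_mem, graft_of_not_mem cfg_not_mem, swap_cfg_eq,
    graftTerm_four, graftTerm_four] at h
  simp only [cfg, Matrix.cons_val_zero, Matrix.cons_val_one, Matrix.cons_val_two, Matrix.cons_val_three,
    Matrix.head_cons, Matrix.tail_cons, zero_sub, dirFactor_e0, dirFactor_e1, mul_zero, mul_one] at h
  have hpos : 0 < S 2 ![0, e0] := hnd _ pair_mem
  nlinarith [mul_pos hpos hpos]

/-- **(H3) is load-bearing modulo existence.**  `IsotropyFromOneArm`'s consequent with the normalisation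
clause dropped is EQUIVALENT to the non-existence of any admissible (non-degenerate, translation-invariant,
scale-covariant) pointwise scaling limit of `criticalCorr 3`: given one, its anisotropic graft on the
coincident locus satisfies every remaining hypothesis and is not rotation invariant; with none, the statement
is vacuous. [folklore] -/
theorem consequentWithoutNorm_iff_no_limit :
    (∀ (ρ : ℝ → ℝ) (Δ : ℝ) (S : CorrFamily 3), (∀ δ ∈ Set.Ioc (0:ℝ) 1, 0 < ρ δ) →
        HasPointwiseScalingLimit (criticalCorr 3) ρ S →
        IsNondegenerateTwoPoint S → IsTranslationInvariant S → IsScaleCovariant Δ S →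
        IsRotationInvariant S) ↔
      ¬ ∃ (ρ : ℝ → ℝ) (Δ : ℝ) (S : CorrFamily 3), (∀ δ ∈ Set.Ioc (0:ℝ) 1, 0 < ρ δ) ∧
        HasPointwiseScalingLimit (criticalCorr 3) ρ S ∧
        IsNondegenerateTwoPoint S ∧ IsTranslationInvariant S ∧ IsScaleCovariant Δ S := by
  constructor
  · rintro h ⟨ρ, Δ, S, hρ, hlim, hnd, htr, hsc⟩
    exact graft_not_isRotationInvariant hnd
      (h ρ Δ (graft S) hρ (graft_hasLimit hlim) (graft_isNondegenerateTwoPoint hnd)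
        (graft_isTranslationInvariant htr) (graft_isScaleCovariant hsc))
  · intro hne ρ Δ S hρ hlim hnd htr hsc
    exact absurd ⟨ρ, Δ, S, hρ, hlim, hnd, htr, hsc⟩ hne

/-- Corollary: under the route's own existence crux `ExistsScaleCovariantLimit` (stmt-CriticalPhenomena-1981)
the un-normalised variant of the consequent is FALSE (the coincident-locus junk of item 0637, for rotations).
[folklore] -/
theorem consequent_false_without_norm_of_exists
    (hE : Theses.ArmHyperscaling.ExistsScaleCovariantLimit) :
    ¬ ∀ (ρ : ℝ → ℝ) (Δ : ℝ) (S : CorrFamily 3), (∀ δ ∈ Set.Ioc (0:ℝ) 1, 0 < ρ δ) →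
        HasPointwiseScalingLimit (criticalCorr 3) ρ S →
        IsNondegenerateTwoPoint S → IsTranslationInvariant S → IsScaleCovariant Δ S →
        IsRotationInvariant S := by
  obtain ⟨ρ, Δ, S, hρ, -, hlim, -, hnd, htr, hsc⟩ := hE
  exact fun h => consequentWithoutNorm_iff_no_limit.1 h ⟨ρ, Δ, S, hρ, hlim, hnd, htr, hsc⟩

end Summit.CriticalPhenomena.Ising3DConformalLimit.Cruxes.IsotropyFromOneArm.Negative

end
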